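import Summits.HodgeConjecture.HodgeConjecture.Theses.HeckePrymWeil
import Summits.HodgeConjecture.HodgeConjecture.Theorems.HeckePrymWeilAimedDescendingProof
import Summits.HodgeConjecture.HodgeConjecture.Theorems.WeilTenfoldsSqrtMinus11.Negative.EigenvalueSeparation
import Literature.AlgebraicGeometry.Motives.AbelianVarietyProduct
import Literature.AlgebraicGeometry.Motives.AbelianVarietyProductDimProofs
import Literature.AlgebraicGeometry.Motives.HyperbolicWeilType
import Literature.AlgebraicGeometry.Motives.WeilDiscriminantRealization
import Literature.AlgebraicGeometry.HodgeTheory.WeilClassesFourfoldsProofs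
import Literature.AlgebraicGeometry.HodgeTheory.SemiregularVariationalHodge
import Literature.AlgebraicGeometry.HodgeTheory.KaehlerClass
import HarnessLib.Audit

/-!
# Line `secant-twelvefold-aimed` — the parked secant line RE-BASED on the proved `AimedDescending`
# (crux `HeckePrymWeil.WeilTenfoldsSqrtMinus11`, stmt-HodgeConjecture-1262; crux-strategist s1, 2026-08-17)

Alternative line file, NOT registered (the live registered skeleton is the lead's `quaternionic_norm_anchors`;
this file does not touch it).  Companion card `Lines/secant-twelvefold-aimed.md`; census `STRATEGY-CENSUS.md`
§Strengthen, recommendation R2; no-go `SplitObjectsNoGo.md`.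

Crux ⟸ S⁺ := `HyperbolicTwelvefoldsSqrtMinus11` (the Hodge–Weil classes of every SPLIT `ℚ(√-11)`-Weil abelian
TWELVEFOLD are algebraic, typed verbatim as the hypothesis of the route's support item `AimedDescending` at
`(p,n) = (11,5)`), and S⁺ → crux is the THEOREM `weilTenfolds_of_hyperbolicTwelvefolds` below (pure instantiation
of `Theorems.aimedDescending_proof`, item stmt-14643, CLOSED unconditionally — the CM Weil surface of prescribed
discriminant is constructed in the tree).  So the whole descent half of the parked line
`generic-ppav-secant-descent` (stubs `stub_aimingArithmetic`, `stub_hyperbolicPartner`, `stub_hodgeTypeExterior`,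
`stub_descent`, and the reshaped `stub_mulPow`) is replaced by one theorem, and the line is its T₊ side only:

* `stub_secantSpread` — VERBATIM the parked line's Stub 1 (THE BET: a split hyperbolic K-compatibly Kähler-
  polarised `ℚ(√-11)` anchor twelvefold — intended `X × X̂`, `X` a ppav sixfold — THROUGH WHICH the Weil sections
  spread along every smooth projective family; = a semiregular (twisted) theta-CI secant^⊠2 object at ONE anchor,
  Markman arXiv:2502.03415 Cor. 1.3.2 + Lemma 8.3.4 + §7.5, with `rank ob_F = 30`; triage pass ×3).  Same
  statement, same name: a proof of either copy proves both.
* `stub_reachRouteTyping` — γ ⟹ S⁺ IN THE ROUTE'S TYPING: from Stub 1, the Weil classes of every split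
  twelvefold `(A, φ)` — split witnessed, as in `AimedDescending` / `HyperbolicEightfoldsSqrtMinus7`, by a
  projective embedding `e` and a rational `a ≠ 0` with `IsHyperbolicWeilType A φ 6 (11·e^*a + φ^*e^*a)` — are
  algebraic.  Content: the parked line's Stub 2 (PEL family of `U(H₀)` with neat level through THE anchor,
  Landherr, flat Weil sections, the tree's PROVED isogeny descent) PLUS the typing bridge "the `K`-symmetrised
  hyperplane class `h = 11·e^*a + φ^*e^*a` is `±` a `K`-compatible polarization: rational, algebraic, `φ^*h = 11h`
  (`(φ≫φ)^* = 121` on `H²`), `Q_h` non-degenerate (hard Lefschetz), `±h` Kähler (Fubini–Study)" — so that no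
  Kähler / non-degeneracy hypothesis is left on the consumer's side and `aimedDescending_proof` applies verbatim.

Composition `WeilTenfoldsSqrtMinus11_of : Registered.stub_secantSpread → Registered.stub_reachRouteTyping → crux`
(BY NAME; sorry-free): `weilTenfolds_of_hyperbolicTwelvefolds (h₂ h₁)`.

Why this and not the live line (strategist's reading, census §0): after `SplitObjectsNoGo.md` the live bet
`stub_tensorAnchorObjectPol` has no candidate object at the CM anchors of the NON-split components (direct sums of
line bundles are never semiregular with Weil charge; nothing else was ever proposed there), while S⁺ lives in the
ONE component that has tensor anchors `X₆ × X̂₆` for every abelian sixfold (Weil classes algebraic there by FFT),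
where purity of `κ(E)` is automatic (Cor. 1.3.2) and the bet is `∃` ONE good sixfold, not `∀ Y ∀ θ ∀ x`.
Disproof used (`Disproof.lean` cycle 3, F9): S1 ⟸ HC for any anchor (`¬S1 → ¬HC`), S2-type reach ⟸ `HWA(11,6)`;
no `_false_without_` theorem concerns these two stubs (the two for `stub_aimingArithmetic` are moot: that stub is
gone); SCOPE "every δ" honoured by `AimedDescending`.  `ledger negatives`: 3 entries, unrelated.
-/

noncomputable section

-- single-problem summit (Problem = Summit): the mandated namespace repeats `HodgeConjecture`.
set_option linter.dupNamespace false

open CategoryTheory Complex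
open Literature.AlgebraicGeometry Literature.AlgebraicGeometry.Motives
  Literature.AlgebraicGeometry.HodgeTheory Literature.AlgebraicTopology.SingularHomology
open Summit.HodgeConjecture.HodgeConjecture.Theorems.WeilTenfoldsSqrtMinus11.Negative
open Summit.HodgeConjecture.HodgeConjecture.Theses.HeckePrymWeil

namespace Summit.HodgeConjecture.HodgeConjecture.Cruxes.WeilTenfoldsSqrtMinus11.SecantTwelvefoldAimed

/-! ## §0 The strengthened target S⁺ and the PROVED reduction S⁺ → crux -/

/-- **S⁺ = split `ℚ(√-11)`-Weil TWELVEFOLDS** — verbatim the split-rung hypothesis of `AimedDescending` at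
`(p, n) = (11, 5)`, `m = 6` (same shape as the route crux `HyperbolicEightfoldsSqrtMinus7` at `(7, 4)`).
[cite: vanGeemen1994HodgeAV, Lemma 5.2 (3) and 5.4] [cite: Markman2025SurveySecant, §11.5 Step 2] -/
def HyperbolicTwelvefoldsSqrtMinus11 : Prop :=
  ∀ (A : AbelianVariety ℂ) (φ : A ⟶ A), A.dim = 12 → φ ≫ φ = -((11 : ℤ) • 𝟙 A) →
    ∀ (e : ProjectiveEmbedding A.X) (a : complexBetti (projectiveSpace e.n ℂ) 2),
      IsRationalClass a → a ≠ 0 →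
      IsHyperbolicWeilType A φ 6
        ((11 : ℂ) • complexBetti.map e.ι 2 a + complexBetti.map φ.hom.hom.hom 2 (complexBetti.map e.ι 2 a)) →
      ∀ c : complexBetti A.X 12, IsRationalClass c → IsOfHodgeType 12 A.X 12 6 6 c →
        c ∈ Module.End.eigenspace (complexBetti.map (𝟙 A + φ).hom.hom.hom 12).hom
              ((1 + Complex.I * (Real.sqrt (11 : ℝ) : ℂ)) ^ 12) ⊔
            Module.End.eigenspace (complexBetti.map (𝟙 A + φ).hom.hom.hom 12).hom
              ((1 - Complex.I * (Real.sqrt (11 : ℝ) : ℂ)) ^ 12) →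
        c ∈ algebraicClasses A.X 6

/-- **S⁺ → crux, PROVED**: `aimedDescending_proof` at `(11, 5)` (pure instantiation; all casts `rfl`).
[cite: Markman2025SurveySecant, §11.5 Step 2] [cite: Schoen1998HodgeWeilAddendum, §10 (Proposition and proof)] -/
theorem weilTenfolds_of_hyperbolicTwelvefolds (h12 : HyperbolicTwelvefoldsSqrtMinus11) :
    WeilTenfoldsSqrtMinus11 := by
  have hAD : AimedDescending := Summit.HodgeConjecture.HodgeConjecture.Theorems.aimedDescending_proof
  unfold WeilTenfoldsSqrtMinus11
  unfold HyperbolicTwelvefoldsSqrtMinus11 at h12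
  unfold AimedDescending at hAD
  intro A φ hdim hφ c hc hH hW
  refine hAD 11 (by norm_num) (by norm_num) (by norm_num) 5 (by norm_num) ?_ A φ hdim hφ c hc hH hW
  intro m hm A' φ' hdim' hφ' e a ha ha0 hhyp c' hc' hH' hW'
  subst hm
  exact h12 A' φ' hdim' hφ' e a ha ha0 hhyp c' hc' hH' hW'

/-- `λ ≠ λ̄` one rung up: `(1 + i√11)¹² ≠ (1 - i√11)¹²` (instance of the landed
`weil_plus_pow_ne_minus_pow`, `p = 11 ≠ 3`); the scalar behind the `2×2` inversion used inside Stub 2. -/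
theorem weil12_plus_ne_minus :
    (1 + I * (Real.sqrt (11 : ℝ) : ℂ)) ^ 12 ≠ (1 - I * (Real.sqrt (11 : ℝ) : ℂ)) ^ 12 := by
  have h := weil_plus_pow_ne_minus_pow (p := 11) (by norm_num) (by norm_num) (m := 12) (by norm_num)
  exact_mod_cast h

/-! ## §1 The two stubs (T₊ side of the parked line; Stub 1 verbatim) -/

/-- **Stub 1 — γ: a SECANT ANCHOR THROUGH WHICH WEIL CLASSES SPREAD (variational Hodge for Weil
classes through one split hyperbolic `ℚ(√-11)`-anchor; THE BET; hardest; the secant engine's exact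
deliverable).** VERBATIM the registered Stub 1 of the parked line `generic-ppav-secant-descent`
(crux-plan 2026-08-16, triage pass ×3): there exist a complex abelian twelvefold `A₀`, an endomorphism
`ψ₀` with `ψ₀ ≫ ψ₀ = -11`, an idempotent `e₀` with `e₀ψ₀e₀ = 0`, `(𝟙-e₀)ψ₀(𝟙-e₀) = 0` (a SPLIT =
off-diagonal anchor; intended: Markman's secant anchor `X × X̂`, `X` a principally polarised abelian
SIXFOLD at which the theta-CI secant object is semiregular — an open condition on `X ∈ A₆`,
Prop. 1.2.1), and a class `h₀ ∈ H²(A₀(ℂ); ℂ)` which is rational, supported on a divisor,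
`ψ₀`-compatible (`ψ₀^* h₀ = 11 h₀`), with `Q_{h₀} = h₀¹¹ ⌣ · ⌣ ·` non-degenerate on `H¹`, KÄHLER
(`IsKaehlerClass`) and of HYPERBOLIC Weil type (`det H = +1`; automatic for `(X × X̂, ψ_sec, h_sec)`:
`(-11)⁶ ≡ 1`, Lemma 3.1.3), SUCH THAT: for every smooth projective family `π : 𝒳 → S` of relative
dimension `12` over a smooth, integral, quasi-projective `ℂ`-scheme `S`, every pair of FLAT families of
classes `hh` (degree 2) and `w` (degree 12) (continuous sections of `FiberClass π k`) with values in the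
locus of Hodge classes (rational, of type `(1,1)` resp. `(6,6)`) at EVERY point, and every point `s₀`
whose fibre is identified (`ι₀`) with `A₀.X` so that `hh(s₀) = ι₀^* h₀` and `w(s₀) = ι₀^* c₀` with `c₀`
in the Weil plane of `(A₀, ψ₀)` — the class `w(s)` is ALGEBRAIC on the fibre `𝒳_s` for EVERY
`s ∈ S(ℂ)`. Intended proof = the card's lever: on `X` a SIMPLE rank-2 `P`-secant object `F`
(`ch F = 2α + 2β`, `α + √-11 β = e^{√-11 Θ}`, theta-CI support `12·(Θ∩Θ') + 4·Θ³ + 57·Θ⁴ + 36·Θ⁵ +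
462` points, `ℤ/12`-invariant), Orlov transfer to a reflexive sheaf `E₀` on `X × X̂` with
`κ(E₀) ∈ ℚ[h₀] ⊕ W`, `W`-part `≠ 0` (Markman Cor. 1.3.2, every `n`), SEMIREGULARITY of (an equivariant
descent of) `E₀` — `rank ob_F = n(n-1) = 30` on `HT²(X)`, i.e. `ker ob_F = Ann(P)` (`= 6` at `n = 3`,
Markman Prop. 8.3.x) — then Perry 2026 Thm 1.1 (2) / Buchweitz–Flenner Thm 5.1 + Pridham–Markman for
twisted sheaves on abelian varieties (§7.5, proved): `κ(E₀)` remains algebraic wherever it remains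
Hodge. ∃-form on purpose: ONE anchor where the engine runs; Stub 2 carries it to the whole hyperbolic
class. NB (strategist, `SplitObjectsNoGo.md`): the object must be NON-split — its obstruction classes
along the 36 polarized Weil directions must vanish although no Weil-charged divisor class survives; in
Markman's formalism this is `ob_F|_{Ann(P)} = 0`, `Ann(P) ∩ HT²(X) = Sym²H^{0,1} ⊕ {(dξ^♭, 0, ξ)}`
(dimension `21 + 15 = 36`).
Why it might fail: `rank ob_F > 30` (theta-CI supports obstructed along the `15` gerbe/Poisson
directions of `Ann(P)` — card falsifier (c); control computation (b) at `n = 3` first), or no SIMPLE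
rank-2 object with this `ch` (residual falsifier (a)).
[informal size XL; open — Markman Q. 8.2.4 three genera up, with theta-CI instead of Brill–Noether supports]
[cite: Markman2025SecantWeil, Cor. 1.3.2, Lemma 8.3.4, §7.5 and Question 8.2.4]
[cite: Perry2026Semiregularity, Thm. 1.1 (2)] [cite: BuchweitzFlenner2003, Thm. 5.1] -/
theorem stub_secantSpread :
    ∃ (A₀ : AbelianVariety ℂ) (ψ₀ e₀ : A₀ ⟶ A₀) (h₀ : complexBetti A₀.X 2),
      A₀.dim = 12 ∧ ψ₀ ≫ ψ₀ = -((11 : ℤ) • 𝟙 A₀) ∧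
      e₀ ≫ e₀ = e₀ ∧ e₀ ≫ ψ₀ ≫ e₀ = 0 ∧ (𝟙 A₀ - e₀) ≫ ψ₀ ≫ (𝟙 A₀ - e₀) = 0 ∧
      IsRationalClass h₀ ∧ h₀ ∈ algebraicClasses A₀.X 1 ∧
      complexBetti.map ψ₀.hom.hom.hom 2 h₀ = (11 : ℂ) • h₀ ∧
      (∀ x : complexBetti A₀.X 1,
        (∀ y : complexBetti A₀.X 1, polarizationPairingOne A₀.X h₀ 11 x y = 0) → x = 0) ∧
      IsKaehlerClass 12 A₀.X h₀ ∧ IsHyperbolicWeilType A₀ ψ₀ 6 h₀ ∧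
      ∀ (𝒳 S : SchemeOver ℂ) (π : 𝒳 ⟶ S),
        IsSmoothProjectiveFamily π 12 → IsQuasiProjectiveOver S →
        _root_.AlgebraicGeometry.IsIntegral S.left → _root_.AlgebraicGeometry.Smooth S.hom →
      ∀ (hh : ∀ s : ComplexPoints S, complexBetti (fiberOver π s) (2 * 1))
        (w : ∀ s : ComplexPoints S, complexBetti (fiberOver π s) (2 * 6)),
        Continuous (fun s => (⟨s, hh s⟩ : FiberClass π (2 * 1))) →
        Continuous (fun s => (⟨s, w s⟩ : FiberClass π (2 * 6))) →
        (∀ s, (⟨s, hh s⟩ : FiberClass π (2 * 1)) ∈ locusOfHodgeClasses π 12 1) →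
        (∀ s, (⟨s, w s⟩ : FiberClass π (2 * 6)) ∈ locusOfHodgeClasses π 12 6) →
      ∀ (s₀ : ComplexPoints S) (ι₀ : fiberOver π s₀ ≅ A₀.X) (c₀ : complexBetti A₀.X 12),
        c₀ ∈ Module.End.eigenspace (complexBetti.map (𝟙 A₀ + ψ₀).hom.hom.hom 12).hom
                ((1 + Complex.I * (Real.sqrt (11 : ℝ) : ℂ)) ^ 12) ⊔
              Module.End.eigenspace (complexBetti.map (𝟙 A₀ + ψ₀).hom.hom.hom 12).hom
                ((1 - Complex.I * (Real.sqrt (11 : ℝ) : ℂ)) ^ 12) →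
        hh s₀ = complexBetti.map ι₀.hom (2 * 1) h₀ →
        w s₀ = complexBetti.map ι₀.hom (2 * 6) c₀ →
      ∀ s : ComplexPoints S, w s ∈ algebraicClasses (fiberOver π s) 6 := by
  sorry

/-- **Stub 2 — reach, IN THE ROUTE'S TYPING: γ ⟹ S⁺.**  GIVEN Stub 1 (ONE split hyperbolic K-compatibly
Kähler-polarised anchor `(A₀, ψ₀, h₀)` through which the Weil sections spread along every smooth projective
family): the Hodge–Weil classes of EVERY split `ℚ(√-11)`-Weil abelian twelvefold `(A, φ)` — split witnessed by a
projective embedding `e : A.X ⟶ ℙᴺ` and a rational `a ≠ 0` with `IsHyperbolicWeilType A φ 6 h`,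
`h = 11·e^*a + φ^*e^*a` — are algebraic, i.e. `HyperbolicTwelvefoldsSqrtMinus11`.  Proof sketch (classical): (i)
typing bridge — `h` is rational (`a` is), algebraic (`N¹`: pull-back of a hyperplane class), `φ^*h = 11h`
(`(φ ≫ φ)^* = 121` on `H²`), `Q_h = h¹¹ ⌣ · ⌣ ·` non-degenerate on `H¹` (hard Lefschetz for the Kähler class
`±h`; sign immaterial), `±h` Kähler (`e^*` of the Fubini–Study class; tree: `exists_fubiniStudy_eq_smul_map`,
`IsKaehlerClassVia`); (ii) moduli reach exactly as the parked line's Stub 2 — Landherr (vanGeemen1994HodgeAV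
5.4 (5.4.1)): all hyperbolic rank-12 `K`-Hermitian spaces are isometric up to `ℚ_{>0}`, so `(H₁(A,ℚ), H_h)` is
isometric to THE anchor's; the PEL Shimura variety of `U(H₀)` with neat level is a smooth quasi-projective
connected fine moduli scheme with universal family `π` through `A₀` itself; `A` is `K`-ISOGENOUS to a fibre;
after a finite étale base change `⋀¹²_K R¹π_*ℚ` is a trivial rank-2 system of type `(6,6)` everywhere, giving
flat `w₁, w₂` with `c₁(relative polarisation)` as `hh`; Stub 1 makes them algebraic on every fibre, hence the
whole Weil plane of the fibre (`dim = 2` via `H¹² = ⋀¹²H¹`, `weil12_plus_ne_minus` for the `2×2` inversion);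
(iii) the tree's PROVED isogeny descent `HodgeTheory.mem_algebraicClasses_of_isogeny_of_mem_weilClassesOf`
returns to `A`.  Not a costume: anchor-to-component bridge with its own content; strictly about the hyperbolic
component; its conclusion S⁺ is STRONGER than the crux (S⁺ → crux proved in §0) and easier only in the sense of
the census (free generic anchors, automatic purity, `∃`-bet).  Why it might fail: it cannot (classical moduli
theory) — Lean size L–XL (no PEL Shimura varieties / Baily–Borel on real carriers yet; same debt as route item
16866 `DeligneWeilFamily`).
[cite: vanGeemen1994HodgeAV, 5.4 (5.4.1) and 3.6–3.7] [cite: Deligne1982HodgeCycles, proof of Thm. 4.8 with Prop. 4.4] -/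
theorem stub_reachRouteTyping :
    (type_of% stub_secantSpread) → HyperbolicTwelvefoldsSqrtMinus11 := by
  sorry

/-! ### Name-keyed aliases (hypotheses of the composition BY NAME) -/
namespace Registered

/-- Alias of the statement of `stub_secantSpread` (verbatim the parked line's registered Stub 1). -/
abbrev stub_secantSpread : Prop := type_of% _root_.Summit.HodgeConjecture.HodgeConjecture.Cruxes.WeilTenfoldsSqrtMinus11.SecantTwelvefoldAimed.stub_secantSpread
/-- Alias of the statement of `stub_reachRouteTyping`. -/
abbrev stub_reachRouteTyping : Prop := type_of% _root_.Summit.HodgeConjecture.HodgeConjecture.Cruxes.WeilTenfoldsSqrtMinus11.SecantTwelvefoldAimed.stub_reachRouteTyping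

end Registered

/-! ## §2 The composition (concludes the crux BY NAME; sorry-free) -/

/-- **`WeilTenfoldsSqrtMinus11` from the two stubs**: Stub 2 fed Stub 1 gives S⁺ (split `ℚ(√-11)` twelvefolds);
the proved aimed descent gives every `ℚ(√-11)` tenfold discriminant. -/
theorem WeilTenfoldsSqrtMinus11_of
    (h₁ : Registered.stub_secantSpread) (h₂ : Registered.stub_reachRouteTyping) :
    Summit.HodgeConjecture.HodgeConjecture.Theses.HeckePrymWeil.WeilTenfoldsSqrtMinus11 :=
  weilTenfolds_of_hyperbolicTwelvefolds (h₂ h₁)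

/-- The crux from the stubs as they stand (depends on their `sorry`s; shows the composition closes). -/
theorem WeilTenfoldsSqrtMinus11_of_stubs :
    Summit.HodgeConjecture.HodgeConjecture.Theses.HeckePrymWeil.WeilTenfoldsSqrtMinus11 :=
  WeilTenfoldsSqrtMinus11_of stub_secantSpread stub_reachRouteTyping

/-! ## §3 Sanity: the split TENFOLD component is an instance (no separate `n = 5` bet needed) -/

/-- S⁺ already yields the split tenfold component (and everything else): a Markman `n = 5` object at
`X₅ × X̂₅` would be welcome but is not required by this line. [folklore] -/
example (h12 : HyperbolicTwelvefoldsSqrtMinus11) :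
    ∀ (A : AbelianVariety ℂ) (φ : A ⟶ A), A.dim = 10 → φ ≫ φ = -((11 : ℤ) • 𝟙 A) →
      ∀ c : complexBetti A.X 10, IsRationalClass c → IsOfHodgeType 10 A.X 10 5 5 c →
        c ∈ Module.End.eigenspace (complexBetti.map (𝟙 A + φ).hom.hom.hom 10).hom
              ((1 + Complex.I * (Real.sqrt (11 : ℝ) : ℂ)) ^ 10) ⊔
            Module.End.eigenspace (complexBetti.map (𝟙 A + φ).hom.hom.hom 10).hom
              ((1 - Complex.I * (Real.sqrt (11 : ℝ) : ℂ)) ^ 10) →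
        c ∈ algebraicClasses A.X 5 :=
  weilTenfolds_of_hyperbolicTwelvefolds h12

end Summit.HodgeConjecture.HodgeConjecture.Cruxes.WeilTenfoldsSqrtMinus11.SecantTwelvefoldAimed

end
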